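import Literature.NumberTheory.Automorphic.TameLevelCoeffLattice
import Literature.NumberTheory.Automorphic.PadicStageRings
import Literature.NumberTheory.Automorphic.TwistedQuotientRestrictScalars
import Literature.NumberTheory.Automorphic.TwistedQuotientIntFunHeckeReduction
import Literature.NumberTheory.Automorphic.TwistedQuotientIntFunNaturality
import HarnessLib

/-!
# The `ℤ_p`-lattices `M_S ⊂ V_λ(ℚ̄_p)` of the algebraic coefficient system over the stage rings

Topic `NumberTheory/Automorphic`; namespace `Literature.NumberTheory.Automorphic.AlgebraicWeight`.
Definitions with bodies, documented instances and theorems; no named fact, no `sorry`.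

The coefficient space `V = ResGLnCohomology.CoeffModule ℚ̄_p n K λ` of an algebraic weight is a
`ℚ̄_p`-vector space; the integral structures of the proof of [Scholze2015, Thm. V.4.1] live over
`ℤ_p`.  This file sets up:

* the `ℤ_p`-module structure of `V` (restriction of scalars along `ℤ_p → ℚ̄_p`; instances
  `instModulePadicInt`, `instIsScalarTowerPadicInt`), `p`-torsion-freeness, and the representation
  `padicIntRep = π|ℤ_p` of `GL_n(𝔸_K^∞)` (`TwistedQuotient.resScalars` of `padicCoeffRep`);
* `toPadicIntSubmodule` — an `𝒪`-lattice (for a subring `𝒪 ∋ ℤ_p` of `ℚ̄_p`) as a `ℤ_p`-submodule;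
  `span_subring_subset` — spans are monotone in the subring; monotonicity of the integral forms
  `piIntForm ⊆ tensorIntForm ⊆ weylIntForm ⊆ coeffIntForm` in `𝒪`;
* **the stage lattices** `stageLattice S = M_{𝒪_E[S]}` (`ResGLnCohomology.coeffIntForm` over
  `ParallelWeight.stageRing K p S`) as `ℤ_p`-submodules of `V`: monotone in `S`
  (`stageLattice_mono`), stable under the tame level `U` (`stageLattice_stable`), and with `U_r`
  acting trivially modulo `p^s` for `r ≫ 0` (`exists_modTrivialOn_stageLattice`, from
  `exists_forall_padicCoeffRep_sub_mem`) — the hypotheses `hM`, `ModTrivialOn` of the Bockstein /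
  Hecke-reduction files.

## References

* P. Scholze, *On torsion in the cohomology of locally symmetric varieties*, Ann. of Math. 182
  (2015), §V.4, proof of Thm. V.4.1. [Scholze2015]
-/

noncomputable section

open scoped TensorProduct
open Literature.LinearAlgebra.BaseChange Literature.NumberTheory.DiophantineGeometry
open IsDedekindDomain NumberField

namespace Literature.NumberTheory.Automorphic

namespace AlgebraicWeight

variable (K : Type) [Field K] [NumberField K] (n p : ℕ) [Fact p.Prime]
  (lam : (K →+* PadicAlgCl p) → Fin n → ℤ)

/-! ### The `ℤ_p`-structure of `V_λ(ℚ̄_p)` -/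

/-- `V_λ(ℚ̄_p)` as a `ℤ_p`-module, by restriction of scalars along `ℤ_p → ℚ̄_p`. [folklore] -/
instance instModulePadicInt : Module ℤ_[p] (ResGLnCohomology.CoeffModule (PadicAlgCl p) n K lam) :=
  Module.compHom _ (algebraMap ℤ_[p] (PadicAlgCl p))

omit [NumberField K] in
/-- The `ℤ_p`-action is the `ℚ̄_p`-action through `ℤ_p → ℚ̄_p`. [folklore] -/
theorem padicInt_smul_def (z : ℤ_[p]) (v : ResGLnCohomology.CoeffModule (PadicAlgCl p) n K lam) :
    z • v = algebraMap ℤ_[p] (PadicAlgCl p) z • v :=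
  rfl

/-- `ℤ_p → ℚ̄_p → V` is a scalar tower. [folklore] -/
instance instIsScalarTowerPadicInt :
    IsScalarTower ℤ_[p] (PadicAlgCl p) (ResGLnCohomology.CoeffModule (PadicAlgCl p) n K lam) :=
  ⟨fun z c v => by rw [padicInt_smul_def, Algebra.smul_def, mul_smul]⟩

/-- `ℤ_p → ℚ̄_p` is injective. [folklore] -/
theorem algebraMap_padicInt_injective : Function.Injective (algebraMap ℤ_[p] (PadicAlgCl p)) := by
  rw [IsScalarTower.algebraMap_eq ℤ_[p] ℚ_[p] (PadicAlgCl p)]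
  exact (algebraMap ℚ_[p] (PadicAlgCl p)).injective.comp (IsFractionRing.injective ℤ_[p] ℚ_[p])

/-- `V` has no `ℤ_p`-torsion. [folklore] -/
instance instNoZeroSMulDivisorsPadicInt :
    NoZeroSMulDivisors ℤ_[p] (ResGLnCohomology.CoeffModule (PadicAlgCl p) n K lam) :=
  ⟨fun {z v} h => by
    rw [padicInt_smul_def, smul_eq_zero] at h
    rcases h with h | h
    · left
      exact algebraMap_padicInt_injective p (by rw [h, map_zero])
    · exact Or.inr h⟩

omit [NumberField K] in
/-- Multiplication by `p^s` is injective on `V`. [folklore] -/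
theorem pow_smul_injective (s : ℕ) :
    Function.Injective fun v : ResGLnCohomology.CoeffModule (PadicAlgCl p) n K lam =>
      (((p ^ s : ℕ) : ℤ_[p])) • v :=
  smul_right_injective _ (by exact_mod_cast pow_ne_zero s (Fact.out : p.Prime).ne_zero)

/-- **`π|ℤ_p`**: the action of `GL_n(𝔸_K^∞)` on `V_λ(ℚ̄_p)` regarded `ℤ_p`-linearly. [folklore] -/
abbrev padicIntRep :
    Representation ℤ_[p] (BigHeckeGLn.FiniteAdelicGL n K)
      (ResGLnCohomology.CoeffModule (PadicAlgCl p) n K lam) :=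
  TwistedQuotient.resScalars ℤ_[p] (ResGLnCohomology.padicCoeffRep n K p lam)

/-- Unfolding lemma. [folklore] -/
theorem padicIntRep_apply (g : BigHeckeGLn.FiniteAdelicGL n K)
    (v : ResGLnCohomology.CoeffModule (PadicAlgCl p) n K lam) :
    padicIntRep K n p lam g v = ResGLnCohomology.padicCoeffRep n K p lam g v :=
  rfl

/-! ### `𝒪`-lattices as `ℤ_p`-lattices; monotonicity in the subring -/

section Generic

variable {k : Type} [Field k] {W : Type*} [AddCommGroup W] [Module k W]

/-- **Spans are monotone in the subring**: for `𝒪 ≤ 𝒪'` and `S ⊆ S'`,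
`span_𝒪 S ⊆ span_{𝒪'} S'` (as subsets). [folklore] -/
theorem span_subring_subset {𝒪 𝒪' : Subring k} (h : 𝒪 ≤ 𝒪') {S S' : Set W} (hS : S ⊆ S') :
    (Submodule.span 𝒪 S : Set W) ⊆ Submodule.span 𝒪' S' := by
  intro x hx
  induction hx using Submodule.span_induction with
  | mem y hy => exact Submodule.subset_span (hS hy)
  | zero => exact Submodule.zero_mem _
  | add y z _ _ hy hz => exact Submodule.add_mem _ hy hz
  | smul c y _ hy =>
    have hc : (c • y : W) = (⟨(c : k), h c.2⟩ : 𝒪') • y := rfl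
    rw [SetLike.mem_coe, hc]
    exact Submodule.smul_mem _ _ hy

/-- `𝒪^σ ⊆ 𝒪'^σ`. [folklore] -/
theorem piIntForm_subset {𝒪 𝒪' : Subring k} (h : 𝒪 ≤ 𝒪') (σ : Type*) :
    (piIntForm k 𝒪 σ : Set (σ → k)) ⊆ piIntForm k 𝒪' σ := fun _ hv r => h (hv r)

/-- `intTprods` is monotone in the integral structures (as subsets). [folklore] -/
theorem intTprods_subset {ι : Type*} {V : ι → Type*} [∀ i, AddCommGroup (V i)]
    [∀ i, Module k (V i)] {𝒪 𝒪' : Subring k} (N : ∀ i, Submodule 𝒪 (V i))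
    (N' : ∀ i, Submodule 𝒪' (V i)) (hN : ∀ i, (N i : Set (V i)) ⊆ N' i) :
    intTprods 𝒪 N ⊆ intTprods 𝒪' N' := fun _ ⟨m, hm, hx⟩ => ⟨m, fun i => hN i (hm i), hx⟩

/-- `piTensorIntForm` is monotone in the subring and the integral structures (as subsets).
[folklore] -/
theorem piTensorIntForm_subset {ι : Type*} {V : ι → Type*} [∀ i, AddCommGroup (V i)]
    [∀ i, Module k (V i)] {𝒪 𝒪' : Subring k} (h : 𝒪 ≤ 𝒪') (N : ∀ i, Submodule 𝒪 (V i))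
    (N' : ∀ i, Submodule 𝒪' (V i)) (hN : ∀ i, (N i : Set (V i)) ⊆ N' i) :
    (piTensorIntForm 𝒪 N : Set (⨂[k] i, V i)) ⊆ piTensorIntForm 𝒪' N' :=
  span_subring_subset h (intTprods_subset N N' hN)

/-- `(𝒪^σ)^{⊗d} ⊆ (𝒪'^σ)^{⊗d}`. [folklore] -/
theorem tensorIntForm_subset {𝒪 𝒪' : Subring k} (h : 𝒪 ≤ 𝒪') (σ : Type*) (d : ℕ) :
    (tensorIntForm k 𝒪 σ d : Set (TensorPower k d (σ → k))) ⊆ tensorIntForm k 𝒪' σ d :=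
  piTensorIntForm_subset h _ _ fun _ => piIntForm_subset h σ

/-- `weylIntForm` is monotone in the subring. [folklore] -/
theorem weylIntForm_subset {𝒪 𝒪' : Subring k} (h : 𝒪 ≤ 𝒪') (σ : Type*) {d : ℕ}
    (μ : Nat.Partition d) :
    (weylIntForm k 𝒪 σ μ : Set (weylModule k σ μ)) ⊆ weylIntForm k 𝒪' σ μ := by
  intro y hy
  obtain ⟨x, hx, rfl⟩ := (mem_weylIntForm_iff k 𝒪 σ μ).1 hy
  exact (mem_weylIntForm_iff k 𝒪' σ μ).2 ⟨x, tensorIntForm_subset h σ d hx, rfl⟩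

/-- `GLnCohomology.coeffIntForm` is monotone in the subring. [folklore] -/
theorem glnCoeffIntForm_subset {𝒪 𝒪' : Subring k} (h : 𝒪 ≤ 𝒪') (m : ℕ) (wt : Fin m → ℤ) :
    (GLnCohomology.coeffIntForm k 𝒪 m wt : Set (GLnCohomology.CoeffModule k m wt)) ⊆
      GLnCohomology.coeffIntForm k 𝒪' m wt :=
  weylIntForm_subset h (Fin m) _

/-- **`ResGLnCohomology.coeffIntForm` is monotone in the subring.** [folklore] -/
theorem coeffIntForm_subset {K' : Type} [Field K'] [NumberField K'] {𝒪 𝒪' : Subring k}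
    (h : 𝒪 ≤ 𝒪') (m : ℕ) (lam' : (K' →+* k) → Fin m → ℤ) :
    (ResGLnCohomology.coeffIntForm k 𝒪 m K' lam' : Set (ResGLnCohomology.CoeffModule k m K' lam')) ⊆
      ResGLnCohomology.coeffIntForm k 𝒪' m K' lam' :=
  piTensorIntForm_subset h _ _ fun τ => glnCoeffIntForm_subset h m (lam' τ)

end Generic

/-- **An `𝒪`-lattice as a `ℤ_p`-submodule** (`𝒪 ⊆ ℚ̄_p` a subring containing the image of
`ℤ_p`). [folklore] -/
def toPadicIntSubmodule (𝒪 : Subring (PadicAlgCl p))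
    (h𝒪 : ∀ z : ℤ_[p], algebraMap ℤ_[p] (PadicAlgCl p) z ∈ 𝒪)
    (M : Submodule 𝒪 (ResGLnCohomology.CoeffModule (PadicAlgCl p) n K lam)) :
    Submodule ℤ_[p] (ResGLnCohomology.CoeffModule (PadicAlgCl p) n K lam) where
  carrier := M
  zero_mem' := M.zero_mem
  add_mem' := M.add_mem
  smul_mem' z v hv := by
    have h : z • v = (⟨algebraMap ℤ_[p] (PadicAlgCl p) z, h𝒪 z⟩ : 𝒪) • v := rfl
    rw [h]
    exact M.smul_mem _ hv

omit [NumberField K] in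
/-- Membership is membership in `M`. [folklore] -/
@[simp]
theorem mem_toPadicIntSubmodule_iff (𝒪 : Subring (PadicAlgCl p))
    (h𝒪 : ∀ z : ℤ_[p], algebraMap ℤ_[p] (PadicAlgCl p) z ∈ 𝒪)
    (M : Submodule 𝒪 (ResGLnCohomology.CoeffModule (PadicAlgCl p) n K lam))
    (v : ResGLnCohomology.CoeffModule (PadicAlgCl p) n K lam) :
    v ∈ toPadicIntSubmodule K n p lam 𝒪 h𝒪 M ↔ v ∈ M :=
  Iff.rfl

/-! ### The stage lattices -/

/-- **The stage lattice `M_S = M_{𝒪_E[S]} ⊂ V_λ(ℚ̄_p)`** as a `ℤ_p`-submodule: the integral form of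
`V_λ` over the stage ring `𝒪_E[S]`. [cite: Scholze2015, §V.4 (proof of Thm. V.4.1)] -/
def stageLattice (S : Finset (PadicAlgCl p)) :
    Submodule ℤ_[p] (ResGLnCohomology.CoeffModule (PadicAlgCl p) n K lam) :=
  toPadicIntSubmodule K n p lam (ParallelWeight.stageRing K p S)
    (ParallelWeight.algebraMap_padicInt_mem_stageRing K p S)
    (ResGLnCohomology.coeffIntForm (PadicAlgCl p) (ParallelWeight.stageRing K p S) n K lam)

/-- Membership in the stage lattice. [folklore] -/
theorem mem_stageLattice_iff (S : Finset (PadicAlgCl p))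
    (v : ResGLnCohomology.CoeffModule (PadicAlgCl p) n K lam) :
    v ∈ stageLattice K n p lam S ↔
      v ∈ ResGLnCohomology.coeffIntForm (PadicAlgCl p) (ParallelWeight.stageRing K p S) n K lam :=
  Iff.rfl

/-- **The stage lattices are monotone in `S`.** [folklore] -/
theorem stageLattice_mono {S S' : Finset (PadicAlgCl p)} (h : S ⊆ S') :
    stageLattice K n p lam S ≤ stageLattice K n p lam S' := fun _ hv =>
  (mem_stageLattice_iff K n p lam S' _).2
    (coeffIntForm_subset (ParallelWeight.stageRing_mono K p h) n lam hv)

/-- **The stage lattices are stable under the tame level `U ⊆ GL_n(𝒪̂_K)`.**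
[cite: Scholze2015, §V.4 (M_{ξ,K})] -/
theorem stageLattice_stable (𝒰 : BigHeckeGLn.TameLevel n K p) (S : Finset (PadicAlgCl p)) :
    ∀ u ∈ 𝒰.subgroup, ∀ m ∈ stageLattice K n p lam S,
      padicIntRep K n p lam u m ∈ stageLattice K n p lam S :=
  fun _ hu _ hm =>
    (mem_stageLattice_iff K n p lam S _).2
      (ResGLnCohomology.padicCoeffRep_mem_coeffIntForm n K p lam (ParallelWeight.stageRing K p S)
        (ParallelWeight.padicPlaceHom_mem_stageRing K p S) (𝒰.le_glFiniteIntegralLevel hu)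
        ((mem_stageLattice_iff K n p lam S _).1 hm))

omit [NumberField K] in
/-- An `𝒪`-multiple `(m : 𝒪) • y` is the `ℤ_p`-multiple `(m : ℤ_p) • y`. [folklore] -/
theorem subring_natCast_smul_eq (𝒪 : Subring (PadicAlgCl p)) (m : ℕ)
    (y : ResGLnCohomology.CoeffModule (PadicAlgCl p) n K lam) :
    ((m : 𝒪) : 𝒪) • y = ((m : ℤ_[p])) • y := by
  rw [padicInt_smul_def, map_natCast]
  change ((m : 𝒪) : PadicAlgCl p) • y = _
  rw [Subring.coe_natCast]

/-- **`U_r` acts trivially on `M_S / p^s` for `r ≫ 0`**: the hypothesis `ModTrivialOn` of the Hecke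
reduction, from `exists_forall_padicCoeffRep_sub_mem`. [cite: Scholze2015, §V.4 (proof of Thm. V.4.1)] -/
theorem exists_modTrivialOn_stageLattice (𝒰 : BigHeckeGLn.TameLevel n K p)
    (S : Finset (PadicAlgCl p)) (s : ℕ) :
    ∃ r : ℕ, TwistedQuotient.ModTrivialOn (padicIntRep K n p lam) (stageLattice K n p lam S)
      (stageLattice_stable K n p lam 𝒰 S) (p ^ s) (𝒰.tower r) := by
  obtain ⟨r, hr⟩ := ResGLnCohomology.exists_forall_padicCoeffRep_sub_mem n K p lam
    (ParallelWeight.stageRing K p S) (ParallelWeight.padicPlaceHom_mem_stageRing K p S) 𝒰 s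
  refine ⟨r, fun u hu m => ?_⟩
  have h := hr u hu (m : ResGLnCohomology.CoeffModule (PadicAlgCl p) n K lam) m.2
  rw [Submodule.ideal_span_singleton_smul, Submodule.mem_smul_pointwise_iff_exists] at h
  obtain ⟨y, hy, hyeq⟩ := h
  rw [TwistedQuotient.mem_nsmulSubmodule_iff]
  refine ⟨⟨y, hy⟩, Subtype.ext ?_⟩
  change (((p ^ s : ℕ) : ℤ_[p])) • y = ResGLnCohomology.padicCoeffRep n K p lam u m - m
  have hc : ((p ^ s : ℕ) : ParallelWeight.stageRing K p S) =
      ((p : ℕ) : ParallelWeight.stageRing K p S) ^ s := Nat.cast_pow p s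
  rw [← hyeq, ← subring_natCast_smul_eq K n p lam, hc]

end AlgebraicWeight

end Literature.NumberTheory.Automorphic
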